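import Summits.BirchSwinnertonDyer.BirchSwinnertonDyer.Theorems.PrintCf2RubinValueTwoEllipticUnitsTwoVariableIntegral
import HarnessLib

/-!
# The MOMENTS of de Shalit's two-variable measure on `Γ_K`, read at the modulus `𝔣_m` (II.4.14 (38), p-adic side at `j = 0`, with II.4.12
# (29)↔(31), II.4.7 (16)–(17)): `∫_{Γ_K} χ dμ = (χ(g_𝔠) − N𝔠)⁻¹ Σ_{c ∈ Γ_K/G_m} χ(r_c) · [S⁰]D^k H_{(r_c⁻¹ • e_{𝔣_m}(𝔠))_𝔓}`
# for every multiplicative `χ` continuous for the `m`-th tower whose restriction to `G_m = Gal(K̄/K(𝔣_m))` is `κ^{k+1}`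

Cell `bsd-print-cf2`, width seat `bsd-line-cf2-p1-w8` g11 (piece (H4) of the measure side); `--supports` the banked S3a item
stmt-BirchSwinnertonDyer-24721 (helper, Theses-free).  THEOREMS ONLY; CONDITIONAL on the published named facts `DeShalit1987.prop24_iii_unit`,
`prop25_i_normRelation` (hypotheses of §2, never asserted); §1 uses no named fact.

PRINT (de Shalit II.4.14, proof of (38) at `j = 0`, p. 71–72, = II.4.11/4.12 (31) at the modulus `𝔣 = 𝔤𝔭̄^m`): for a character `ε = φ^k χ` of
`𝒢 = Gal(K(𝔣p^∞)/K)` whose restriction to `G = Gal(K(𝔣𝔭^∞)/K(𝔣))` is `κ^k` (the lane's index `k ↦ k + 1`),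
`(N𝔞 − ε(σ_𝔞)) ∫_𝒢 ε dμ(𝔣) = Σ_𝔠 ε(𝔠⁻¹) ∫_G κ^k dμ_{σ_𝔠 e(𝔞)} = Σ_𝔠 ε(𝔠⁻¹) · D^k log g̃_{σ_𝔠 e(𝔞)}(0)` ((16)–(17) with I.3.4 (10)–(11)); the right side
is then read as Eisenstein numbers (II.4.9–4.10, the CM bridge) and as `L`-values (II.3.5, II.4.11).  At `p = 2` with `𝒪_v ≅ ℤ₂` the group `Δ`
of II.4.1 is trivial (II.4.17): `K(𝔣v) = K(𝔣)`, the tower `K(𝔣v^{n+1})` of `G` has top level `U_0 = G` (`rayAdicTower_U_zero_eq_top`), so de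
Shalit's `i(β)` IS the measure `μ_β` of I.3.4 (no coset extension inside `G`).  THIS file proves, in the lane's currency:

* §1 (any relative unit `β ∈ 𝒰_𝔓`, no named fact) `localMeasureFamily_μ_eq_comap` — **`i_𝔓(β) = D_β` levelwise** (`U_0 = G`: the `induce`
  of I.3.4 reads `D_β` on every cell, `induce_μ_of_transLE_eq_one_seriesFamily`); ★★ `integral_character_pow_succ_localMeasureFamily_eq` —
  **`∫_G κ(g)^{k+1} d i_𝔓(β)(g) = [S⁰] D^k H_β`** (I.3.4 (10) + the socket (11), `integral_comap_indicator_character_pow_succ_seriesFamily`, the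
  indicator of `U_0 = G` being `1`), `H_β = Θ(j((δ_E g_β)~) ∘ ϑ)` the `Θ`-read relative log-free series;
* §2 ★★★ `integral_twoVariable_character_pow_succ` — for the two-variable `μ` of
  `…EllipticUnitsTwoVariableMeasure.exists_twoVariable_groupDistribution_ellipticUnitsGlobal`, every `𝔠`, every modulus index `m`, every `k`
  and every multiplicative `χ : Γ_K → ℂ₂` with `χ(1) = 1`, continuous for the `m`-th tower, `χ(g_𝔠) ≠ N𝔠`, whose restriction to `G_m` is
  `σ ↦ (e₂κ_v(σ))^{−(k+1)}` (read in `ℂ₂`):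
  **`∫_{Γ_K} χ dμ = (χ(g_𝔠) − N𝔠)⁻¹ · Σ_{c ∈ Γ_K/G_m} χ(r_c) · [S⁰] D^k H_{(r_c⁻¹ • e_{𝔣_m}(𝔠))_𝔓}`** — `integral_twoVariable_eq_sum` (H2) with
  the local integrals evaluated by §1 at the Galois conjugates of the elliptic units.  The restriction hypothesis is the output shape of the avatar
  identity on the ray (`…AvatarOnRayExact`, A2); the right side is the input of the CM bridge (A3) via the Coates–Wiles socket
  `constantCoeff_mahlerD_iterate_subst_compSeriesC_relTildeSeries`.

HONEST FRAMING: an assembly of accepted kernel theorems; nothing here closes a crux; no summit statement is proved; BSD is not proved by any of this.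

## References
* [deShalit1987] E. de Shalit, *Iwasawa theory of elliptic curves with complex multiplication* (1987), II.4.14 (38) (p. 71–72), II.4.7 (16)–(17)
  (p. 60), II.4.12 (29)–(31) (p. 66–69), I.3.4 (10), I.3.5 (11) (p. 18), II.4.17 (p. 77–78).
-/

-- the summit namespace `Summit.BirchSwinnertonDyer.BirchSwinnertonDyer` repeats the problem name by design (D-0017)
set_option linter.dupNamespace false
set_option autoImplicit false

noncomputable section

open scoped Classical nonZeroDivisors
open scoped NumberField
open Field IsDedekindDomain IsDedekindDomain.HeightOneSpectrum ValuativeRel IsLocalRing MvPowerSeries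
open Literature.NumberTheory.NumberFields
open Literature.NumberTheory.GaloisRepresentations Literature.NumberTheory.GaloisRepresentations.IsNonarchimedeanLocalField
  Literature.NumberTheory.GaloisRepresentations.LubinTate Literature.NumberTheory.GaloisRepresentations.ArtinLocalGlobal
  Literature.NumberTheory.PAdicHodge
open Literature.NumberTheory.EllipticCurves Literature.NumberTheory.EllipticCurves.GroupDistribution
open Literature.NumberTheory.ComplexMultiplication.EllipticUnits
open Literature.NumberTheory.LFunctions.AbelianDensity (artinSymbol)
open Summit.BirchSwinnertonDyer.BirchSwinnertonDyer.Theorems.PrintCf2.EllipticUnitsLocal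

/-! ## §1. At `p = 2` (`𝒪_v ≅ ℤ₂`): `i_𝔓(β) = D_β`, and its moments are `[S⁰] D^k H_β` -/

namespace Summit.BirchSwinnertonDyer.BirchSwinnertonDyer.Theorems.PrintCf2.EllipticUnitsGlobal

variable {K : Type} [Field K] [NumberField K] {𝔪 : Ideal (𝓞 K)} {v : HeightOneSpectrum (𝓞 K)}

section Local

attribute [local instance] ltNormUniformSpace ltNormIsUniformAddGroup rk1 nF nE fintypeResidueField
attribute [local instance] RelNormCoherentUnits.instCommMonoid

variable [NumberField.IsTotallyComplex K]
  (h𝔪0 : 𝔪 ≠ ⊥) (hv : ¬ 𝔪 ≤ v.asIdeal) (hw : ∀ u : (𝓞 K)ˣ, (u : 𝓞 K) - 1 ∈ 𝔪 → u = 1)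
  (hq : residueFieldCard (v.adicCompletion K) = 2)
  (h2 : (valuation (v.adicCompletion K)).IsUniformizer ((((2 : ℕ) : 𝒪[v.adicCompletion K]) : v.adicCompletion K)))
  (u : 𝒪[v.adicCompletion K]ˣ)
  (E : IntermediateField (v.adicCompletion K) (AlgebraicClosure (v.adicCompletion K)))
  [FiniteDimensional (v.adicCompletion K) E] [IsGalois (v.adicCompletion K) E] (hE : E ≤ maxUnramified (v.adicCompletion K))
  {σ₀ : absoluteGaloisGroup (v.adicCompletion K)} (hσ₀ : IsAbsArithFrob σ₀)
  {ε : (maxUnramifiedCompletion (v.adicCompletion K))ˣ}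
  (hε : maxUnramifiedCompletion.galAut (v.adicCompletion K) σ₀ (ε : maxUnramifiedCompletion (v.adicCompletion K)) =
    algebraMap 𝒪[v.adicCompletion K] (maxUnramifiedCompletion (v.adicCompletion K)) (u : 𝒪[v.adicCompletion K]) *
      (ε : maxUnramifiedCompletion (v.adicCompletion K)))
  (θ : CompletedAlgClosure (v.adicCompletion K) →+* ℂ_[2]) (hθc : Continuous θ)
  (hθ1 : ∀ z : CBall (v.adicCompletion K), ‖θ (z : CompletedAlgClosure (v.adicCompletion K))‖ ≤ 1)
  (hθζ : ∀ ζ' : ℂ_[2], (∃ n : ℕ, ζ' ^ 2 ^ n = 1) →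
    ∃ ζ : CompletedAlgClosure (v.adicCompletion K), (∃ n : ℕ, ζ ^ 2 ^ n = 1) ∧ θ ζ = ζ')
  (j : unitBall E →+* UnrCoeff (v.adicCompletion K))
  (hj : j.comp (algebraMap (LTCoeff (v.adicCompletion K)) (unitBall E)) =
    (intToUnrCoeff (v.adicCompletion K)).comp (LTCoeff.of (v.adicCompletion K)).symm.toRingHom)
  (hjC : (algebraMap (UnrCoeff (v.adicCompletion K)) (CBall (v.adicCompletion K))).comp j = unitBallToCBall E)
  (e₂ : v.adicCompletionIntegers K ≃+* ℤ_[2])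
  (hΘe : ∀ a : 𝒪[v.adicCompletion K], (θ.comp ((CBall (v.adicCompletion K)).subtype.comp
      (algebraMap (UnrCoeff (v.adicCompletion K)) (CBall (v.adicCompletion K))))) (intToUnrCoeff (v.adicCompletion K) a) =
    padicIntCast ℂ_[2] (((e₂ : v.adicCompletionIntegers K →+* ℤ_[2]).comp
      (integerEquivAdicCompletionIntegers v).toRingHom) a))
  (ψ : (n : ℕ) → ↥(absRestrictNormalHom (rayClassField K 𝔪)).ker ⧸ (rayAdicTower (𝔪 := 𝔪) h𝔪0 v).U n → ZMod (2 ^ (n + 1)))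
  (hψ : ∀ (n : ℕ) (g : ↥(absRestrictNormalHom (rayClassField K 𝔪)).ker), g ∈ (rayAdicTower (𝔪 := 𝔪) h𝔪0 v).U 0 →
    ψ n ((rayAdicTower (𝔪 := 𝔪) h𝔪0 v).proj n g) =
      PadicInt.toZModPow (n + 1) ((((Units.map (e₂ : v.adicCompletionIntegers K →+* ℤ_[2]).toMonoidHom).comp
        (rayAdicCharacter h𝔪0 hv hw))⁻¹ g : ℤ_[2]ˣ) : ℤ_[2]))
  [hN : ∀ n, ((rayAdicTower (𝔪 := 𝔪) h𝔪0 v).U n).Normal]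

include hv hw e₂ in
/-- **Every cell of `G = Gal(K̄/K(𝔪))` lies in `U_0`** at a place with `𝒪_v ≅ ℤ₂` (`U_0 = G`, `rayAdicTower_U_zero_eq_top`: `K(𝔪v) = K(𝔪)`).
[cite: deShalit1987, II.4.1 (p. 56), II.4.17 (p. 77–78)] -/
theorem rayAdicTower_proj_zero_eq_one (σ : ↥(absRestrictNormalHom (rayClassField K 𝔪)).ker) : (rayAdicTower (𝔪 := 𝔪) h𝔪0 v).proj 0 σ = 1 :=
  (QuotientGroup.eq_one_iff σ).mpr (by rw [rayAdicTower_U_zero_eq_top h𝔪0 hv hw e₂]; exact Subgroup.mem_top σ)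

include hv hw e₂ in
/-- The level-`0` class of every cell is trivial (`U_0 = G`). [cite: deShalit1987, II.4.1 (p. 56), II.4.17 (p. 77–78)] -/
theorem rayAdicTower_transLE_eq_one (n : ℕ) (a : ↥(absRestrictNormalHom (rayClassField K 𝔪)).ker ⧸ (rayAdicTower (𝔪 := 𝔪) h𝔪0 v).U n) :
    (rayAdicTower (𝔪 := 𝔪) h𝔪0 v).transLE (Nat.zero_le n) a = 1 := by
  obtain ⟨y, rfl⟩ := QuotientGroup.mk_surjective a
  exact rayAdicTower_proj_zero_eq_one h𝔪0 hv hw e₂ y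

set_option maxHeartbeats 800000 in
include hq hj hΘe in
/-- ★ **`i_𝔓(β) = D_β` levelwise at `p = 2`**: the `induce` of I.3.4 reads the comapped Amice inverse `D_β` of the `Θ`-read relative log-free
series on every cell, because every cell lies in `U_0 = G` (`induce_μ_of_transLE_eq_one_seriesFamily`; `U_0`-equivariance from
`seriesFamily_hgal_rayAction`). [cite: deShalit1987, I.3.4 (p. 18), II.4.6 (13)–(14) (p. 59), II.4.17 (p. 77–78)] -/
theorem localMeasureFamily_μ_eq_comap (β : RelNormCoherentUnits (isUniformizer_unit_mul h2 u) E) (n : ℕ)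
    (a : ↥(absRestrictNormalHom (rayClassField K 𝔪)).ker ⧸ (rayAdicTower (𝔪 := 𝔪) h𝔪0 v).U n) :
    (localMeasureFamily h𝔪0 hv hw hq h2 u E hE hσ₀ hε θ hθ1 j hjC e₂ ψ hψ β).μ n a =
      (GroupDistribution.comap (restrictUnits ((invAmice₁ 2 ((PowerSeries.subst (compSeriesC h2 hσ₀ u hε)
        ((relTildeSeries (isUniformizer_unit_mul h2 u) E hq hE hσ₀
          (LTCoeff.of (v.adicCompletion K) (u : 𝒪[v.adicCompletion K])) β).map j)).map
        (θ.comp ((CBall (v.adicCompletion K)).subtype.comp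
          (algebraMap (UnrCoeff (v.adicCompletion K)) (CBall (v.adicCompletion K))))))
        (norm_coeff_relSeries_le_one hq h2 u E hE hσ₀ hε θ hθ1 j hjC β)).density
        (ProfiniteTower.padicInt_isUniform 2) (unitInv ℂ_[2]) uniformContinuous_unitInv norm_unitInv_le))
        ψ ((rayAdicTower (𝔪 := 𝔪) h𝔪0 v).cellMap_trans (((Units.map (e₂ : v.adicCompletionIntegers K →+* ℤ_[2]).toMonoidHom).comp
          (rayAdicCharacter h𝔪0 hv hw))⁻¹) ψ hψ)
        ((rayAdicTower (𝔪 := 𝔪) h𝔪0 v).cellMap_injective (((Units.map (e₂ : v.adicCompletionIntegers K →+* ℤ_[2]).toMonoidHom).comp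
          (rayAdicCharacter h𝔪0 hv hw))⁻¹) (mem_rayAdicTower_iff_inv h𝔪0 h𝔪0 hv hw e₂ le_rfl hv) ψ hψ)
        ((rayAdicTower (𝔪 := 𝔪) h𝔪0 v).cellMap_fiberSurj (((Units.map (e₂ : v.adicCompletionIntegers K →+* ℤ_[2]).toMonoidHom).comp
          (rayAdicCharacter h𝔪0 hv hw))⁻¹) (mem_rayAdicTower_iff_inv h𝔪0 h𝔪0 hv hw e₂ le_rfl hv)
          (exists_toZModPow_padicRayAdicCharacter_inv_eq h𝔪0 h𝔪0 hv hw e₂ le_rfl hv) ψ hψ)).μ n a := by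
  letI := rayAction h𝔪0 hv hw (isUniformizer_unit_mul h2 u) E hE
  exact induce_μ_of_transLE_eq_one_seriesFamily (hq := hq) (h2 := h2) (hσ₀ := hσ₀) (u := u) (hε := hε)
    (Θ := θ.comp ((CBall (v.adicCompletion K)).subtype.comp
      (algebraMap (UnrCoeff (v.adicCompletion K)) (CBall (v.adicCompletion K)))))
    (e := (e₂ : v.adicCompletionIntegers K →+* ℤ_[2]).comp (integerEquivAdicCompletionIntegers v).toRingHom) (hΘe := hΘe)
    (κ := (((Units.map (e₂ : v.adicCompletionIntegers K →+* ℤ_[2]).toMonoidHom).comp (rayAdicCharacter h𝔪0 hv hw))⁻¹))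
    (hU := mem_rayAdicTower_iff_inv h𝔪0 h𝔪0 hv hw e₂ le_rfl hv)
    (hκ := exists_toZModPow_padicRayAdicCharacter_inv_eq h𝔪0 h𝔪0 hv hw e₂ le_rfl hv) (ψ := ψ) (hψ := hψ)
    (φ := fun β : RelNormCoherentUnits (isUniformizer_unit_mul h2 u) E ↦
      (relTildeSeries (isUniformizer_unit_mul h2 u) E hq hE hσ₀ (LTCoeff.of (v.adicCompletion K) (u : 𝒪[v.adicCompletion K])) β).map j)
    (hgal := seriesFamily_hgal_rayAction (h𝔪 := h𝔪0) (hv := hv) (hw := hw) (h2 := h2) (u := u) (E := E) (hE := hE) (hq := hq)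
      (hσ₀ := hσ₀) (uL := LTCoeff.of (v.adicCompletion K) (u : 𝒪[v.adicCompletion K])) (j := j) (hj := hj)
      (e := (e₂ : v.adicCompletionIntegers K →+* ℤ_[2]).comp (integerEquivAdicCompletionIntegers v).toRingHom)
      (𝒰 := rayAdicTower (𝔪 := 𝔪) h𝔪0 v)
      (κ := (((Units.map (e₂ : v.adicCompletionIntegers K →+* ℤ_[2]).toMonoidHom).comp (rayAdicCharacter h𝔪0 hv hw))⁻¹))
      (hκ := padicRayAdicCharacter_inv_apply h𝔪0 hv hw e₂))
    (hC := norm_coeff_relSeries_le_one hq h2 u E hE hσ₀ hε θ hθ1 j hjC) (hC0 := zero_le_one) (hCb := fun _ ↦ le_rfl) β n a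
    (rayAdicTower_transLE_eq_one h𝔪0 hv hw e₂ n a)

set_option maxHeartbeats 800000 in
include hq hj hΘe hθc hθζ in
/-- ★★ **THE MOMENTS OF THE ONE-`𝔓` FAMILY at `p = 2`: `∫_G κ(g)^{k+1} d i_𝔓(β)(g) = [S⁰] D^k H_β`** for EVERY relative norm-coherent unit
`β ∈ 𝒰_𝔓` and every `k` (de Shalit I.3.4 (10) with the socket (11): `∫_{ℤ₂ˣ} x^{k+1} d(x⁻¹D_{H_β}) = [S⁰]D^k H_β`, for the relative units by the
trace-zero property, `seriesFamily_hsock_of_relNormCoherentUnits`) — `i_𝔓(β) = D_β` (`localMeasureFamily_μ_eq_comap`) and the indicator of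
`U_0 = G` is `1` in `integral_comap_indicator_character_pow_succ_seriesFamily`.  `κ = (e₂κ_v)⁻¹`, `H_β = Θ(j((δ_E g_β)~) ∘ ϑ)`.
[cite: deShalit1987, II.4.7 (17) (p. 60), I.3.4 (10), I.3.5 (11) (p. 18), II.4.17 (p. 77–78)] -/
theorem integral_character_pow_succ_localMeasureFamily_eq (β : RelNormCoherentUnits (isUniformizer_unit_mul h2 u) E) (k : ℕ) :
    (localMeasureFamily h𝔪0 hv hw hq h2 u E hE hσ₀ hε θ hθ1 j hjC e₂ ψ hψ β).integral
        (fun σ ↦ padicIntCast ℂ_[2] (((((Units.map (e₂ : v.adicCompletionIntegers K →+* ℤ_[2]).toMonoidHom).comp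
          (rayAdicCharacter h𝔪0 hv hw))⁻¹) σ : ℤ_[2]) ^ (k + 1))) =
      PowerSeries.constantCoeff (mahlerD^[k] ((PowerSeries.subst (compSeriesC h2 hσ₀ u hε)
        ((relTildeSeries (isUniformizer_unit_mul h2 u) E hq hE hσ₀ (LTCoeff.of (v.adicCompletion K) (u : 𝒪[v.adicCompletion K])) β).map
          j)).map
        (θ.comp ((CBall (v.adicCompletion K)).subtype.comp
          (algebraMap (UnrCoeff (v.adicCompletion K)) (CBall (v.adicCompletion K))))))) := by
  rw [GroupDistribution.integral_congr_of_μ_eq _ _ (localMeasureFamily_μ_eq_comap h𝔪0 hv hw hq h2 u E hE hσ₀ hε θ hθ1 j hj hjC e₂ hΘe ψ hψ β),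
    ← integral_comap_indicator_character_pow_succ_seriesFamily h2 hσ₀ u hε
      (θ.comp ((CBall (v.adicCompletion K)).subtype.comp (algebraMap (UnrCoeff (v.adicCompletion K)) (CBall (v.adicCompletion K)))))
      (((Units.map (e₂ : v.adicCompletionIntegers K →+* ℤ_[2]).toMonoidHom).comp (rayAdicCharacter h𝔪0 hv hw))⁻¹)
      (mem_rayAdicTower_iff_inv h𝔪0 h𝔪0 hv hw e₂ le_rfl hv) (exists_toZModPow_padicRayAdicCharacter_inv_eq h𝔪0 h𝔪0 hv hw e₂ le_rfl hv) ψ hψ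
      (fun β : RelNormCoherentUnits (isUniformizer_unit_mul h2 u) E ↦
        (relTildeSeries (isUniformizer_unit_mul h2 u) E hq hE hσ₀ (LTCoeff.of (v.adicCompletion K) (u : 𝒪[v.adicCompletion K])) β).map j)
      (norm_coeff_relSeries_le_one hq h2 u E hE hσ₀ hε θ hθ1 j hjC)
      (fun β k ↦ seriesFamily_hsock_of_relNormCoherentUnits (hq := hq) (h2 := h2) (u := u) (E := E) (hE := hE)
        (hσ₀ := hσ₀) (j := j) (hε := hε) (θ := θ) (hθc := hθc) (hθ1 := hθ1) (hθζ := hθζ) (hjC := hjC) β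
        (norm_coeff_relSeries_le_one hq h2 u E hE hσ₀ hε θ hθ1 j hjC β) k) β k]
  exact GroupDistribution.integral_congr _ fun σ ↦ by rw [if_pos (rayAdicTower_proj_zero_eq_one h𝔪0 hv hw e₂ σ), one_mul]

end Local

end Summit.BirchSwinnertonDyer.BirchSwinnertonDyer.Theorems.PrintCf2.EllipticUnitsGlobal

/-! ## §2. The moments of the two-variable measure at the modulus `𝔣_m` -/

namespace Summit.BirchSwinnertonDyer.BirchSwinnertonDyer.Theorems.PrintCf2.EllipticUnitsTwoVariable

open Summit.BirchSwinnertonDyer.BirchSwinnertonDyer.Theorems.PrintCf2.EllipticUnitsGlobal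
open Summit.BirchSwinnertonDyer.BirchSwinnertonDyer.Theorems.PrintCf2.EllipticUnitsGlobalCompat

variable {K : Type} [Field K] [NumberField K] {v 𝔩 : HeightOneSpectrum (𝓞 K)}

attribute [local instance] GlobalNormCoherentUnits.instCommMonoid GlobalNormCoherentUnits.galAction
attribute [local instance] ltNormUniformSpace ltNormIsUniformAddGroup rk1 nF nE fintypeResidueField
attribute [local instance] RelNormCoherentUnits.instCommMonoid

variable [NumberField.IsTotallyComplex K]
  -- the prints and the global frame
  (h24iii : DeShalit1987.prop24_iii_unit) (h25 : DeShalit1987.prop25_i_normRelation)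
  (hK : IsImaginaryQuadratic K) (ι : K →+* ℂ)
  -- the moduli `𝔣_{m+1} = 𝔣_m 𝔩`, `𝔩 ∣ 𝔣_m` (e.g. `𝔣_m = 𝔤𝔭̄^{m+1}`), all rigid and prime to `v`
  (𝔣 : ℕ → Ideal (𝓞 K)) (h𝔣succ : ∀ m, 𝔣 (m + 1) = 𝔣 m * 𝔩.asIdeal) (hle : ∀ m, 𝔣 (m + 1) ≤ 𝔣 m) (hdiv : ∀ m, 𝔩.asIdeal ∣ 𝔣 m)
  (h𝔣0 : ∀ m, 𝔣 m ≠ ⊥) (h𝔣1 : ∀ m, 𝔣 m ≠ ⊤) (hv : ∀ m, ¬ 𝔣 m ≤ v.asIdeal) (hw : ∀ (m : ℕ) (u : (𝓞 K)ˣ), (u : 𝓞 K) - 1 ∈ 𝔣 m → u = 1)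
  -- the common local datum at `v`: `π = u·2`, `σ₀`, `ε`, `θ`, `e₂`
  (hq : residueFieldCard (v.adicCompletion K) = 2)
  (h2 : (valuation (v.adicCompletion K)).IsUniformizer ((((2 : ℕ) : 𝒪[v.adicCompletion K]) : v.adicCompletion K)))
  (u : 𝒪[v.adicCompletion K]ˣ)
  {σ₀ : absoluteGaloisGroup (v.adicCompletion K)} (hσ₀ : IsAbsArithFrob σ₀)
  {ε : (maxUnramifiedCompletion (v.adicCompletion K))ˣ}
  (hε : maxUnramifiedCompletion.galAut (v.adicCompletion K) σ₀ (ε : maxUnramifiedCompletion (v.adicCompletion K)) =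
    algebraMap 𝒪[v.adicCompletion K] (maxUnramifiedCompletion (v.adicCompletion K)) (u : 𝒪[v.adicCompletion K]) *
      (ε : maxUnramifiedCompletion (v.adicCompletion K)))
  (θ : CompletedAlgClosure (v.adicCompletion K) →+* ℂ_[2]) (hθc : Continuous θ)
  (hθ1 : ∀ z : CBall (v.adicCompletion K), ‖θ (z : CompletedAlgClosure (v.adicCompletion K))‖ ≤ 1)
  (hθζ : ∀ ζ' : ℂ_[2], (∃ n : ℕ, ζ' ^ 2 ^ n = 1) →
    ∃ ζ : CompletedAlgClosure (v.adicCompletion K), (∃ n : ℕ, ζ ^ 2 ^ n = 1) ∧ θ ζ = ζ')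
  (e₂ : v.adicCompletionIntegers K ≃+* ℤ_[2])
  (hΘe : ∀ a : 𝒪[v.adicCompletion K], (θ.comp ((CBall (v.adicCompletion K)).subtype.comp
      (algebraMap (UnrCoeff (v.adicCompletion K)) (CBall (v.adicCompletion K))))) (intToUnrCoeff (v.adicCompletion K) a) =
    padicIntCast ℂ_[2] (((e₂ : v.adicCompletionIntegers K →+* ℤ_[2]).comp
      (integerEquivAdicCompletionIntegers v).toRingHom) a))
  -- the per-modulus local models: global witnesses `α_m = π^{f_m}`, coefficient fields `E_m ≤ E_{m+1}`, readings `j_m`, cell maps `ψ_m`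
  (α : ℕ → 𝓞 K) (hα0 : ∀ m, α m ≠ 0) (hα𝔣 : ∀ m, α m - 1 ∈ 𝔣 m) (hαw : ∀ m (w : HeightOneSpectrum (𝓞 K)), w ≠ v → α m ∉ w.asIdeal)
  (f : ℕ → ℕ) (hαπ : ∀ m, ((α m : K) : v.adicCompletion K) =
    ((((u : 𝒪[v.adicCompletion K]) * ((2 : ℕ) : 𝒪[v.adicCompletion K]) : 𝒪[v.adicCompletion K]) : v.adicCompletion K)) ^ f m)
  (E : ℕ → IntermediateField (v.adicCompletion K) (AlgebraicClosure (v.adicCompletion K)))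
  [hfd : ∀ m, FiniteDimensional (v.adicCompletion K) (E m)] [hgal : ∀ m, IsGalois (v.adicCompletion K) (E m)]
  (hE : ∀ m, E m ≤ maxUnramified (v.adicCompletion K))
  (hdegE : ∀ (m : ℕ) (w : WeilGroup (v.adicCompletion K)),
    WeilGroup.toAbsGalois (v.adicCompletion K) w ∈ (E m).fixingSubgroup → (f m : ℤ) ∣ WeilGroup.deg w)
  (hEE : ∀ m, E m ≤ E (m + 1))
  (j : ∀ m : ℕ, unitBall (E m) →+* UnrCoeff (v.adicCompletion K))
  (hj : ∀ m, (j m).comp (algebraMap (LTCoeff (v.adicCompletion K)) (unitBall (E m))) =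
    (intToUnrCoeff (v.adicCompletion K)).comp (LTCoeff.of (v.adicCompletion K)).symm.toRingHom)
  (hjC : ∀ m, (algebraMap (UnrCoeff (v.adicCompletion K)) (CBall (v.adicCompletion K))).comp (j m) = unitBallToCBall (E m))
  (hjj : ∀ (m : ℕ) (y : unitBall (E m)), j (m + 1) (inclUnitBall (F := v.adicCompletion K) (hEE m) y) = j m y)
  (ψ : ∀ m n : ℕ, ↥(absRestrictNormalHom (rayClassField K (𝔣 m))).ker ⧸ (rayAdicTower (𝔪 := 𝔣 m) (h𝔣0 m) v).U n → ZMod (2 ^ (n + 1)))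
  (hψ : ∀ (m n : ℕ) (g : ↥(absRestrictNormalHom (rayClassField K (𝔣 m))).ker), g ∈ (rayAdicTower (𝔪 := 𝔣 m) (h𝔣0 m) v).U 0 →
    ψ m n ((rayAdicTower (𝔪 := 𝔣 m) (h𝔣0 m) v).proj n g) =
      PadicInt.toZModPow (n + 1) ((((Units.map (e₂ : v.adicCompletionIntegers K →+* ℤ_[2]).toMonoidHom).comp
        (rayAdicCharacter (h𝔣0 m) (hv m) (hw m)))⁻¹ g : ℤ_[2]ˣ) : ℤ_[2]))
  -- the twists: ideals `𝔠` prime to all `𝔣_m v`, ARBITRARY Galois lifts `g_𝔠 ∈ Γ_K`, elliptic-unit families at every modulus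
  {I : Type*} (idl : I → Ideal (𝓞 K)) (hidl0 : ∀ i, idl i ≠ ⊥) (hidlc : ∀ i m, IsCoprime (idl i) (𝔣 m * v.asIdeal))
  (g : I → absoluteGaloisGroup K)
  (x : ∀ (i : I) (m k : ℕ), rayClassField K (𝔣 m * v.asIdeal ^ (k + 1)))
  (hx : ∀ (i : I) (m k : ℕ), IsThetaValueOne ι (𝔣 m * v.asIdeal ^ (k + 1)) (idl i)
    (algClosureEmb ι ((x i m k : rayClassField K (𝔣 m * v.asIdeal ^ (k + 1))) : AlgebraicClosure K)))
  [hN : ∀ m n, ((rayAdicTower (𝔪 := 𝔣 m) (h𝔣0 m) v).U n).Normal]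
  [hNabs : ∀ m n, ((absRayAdicTower (𝔪' := 𝔣 m) (h𝔣0 m) v).U n).Normal]

set_option maxHeartbeats 1600000 in
include h𝔣succ hdiv hj hΘe hjj hθc hθζ in
/-- ★★★ **THE MOMENTS OF THE TWO-VARIABLE MEASURE, READ AT THE MODULUS `𝔣_m`** (de Shalit II.4.14 (38), p-adic side at `j = 0`, with II.4.12
(29)↔(31) and II.4.7 (16)–(17)): for a bounded distribution `μ` on `Γ_K` along the diagonal tower with `δ_{g_𝔠, N𝔠} μ = i_n(e_{𝔣_n}(𝔠))` at every level
`n` (as produced by `exists_twoVariable_groupDistribution_ellipticUnitsGlobal`), every modulus index `m`, every `k` and every multiplicative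
`χ : Γ_K → ℂ₂` with `χ(1) = 1`, continuous for the `m`-th tower `Gal(K̄/K(𝔣_m v^{n+1}))`, with `χ(g_𝔠) ≠ N𝔠`, and whose restriction to
`G_m = Gal(K̄/K(𝔣_m))` is `σ ↦ (e₂κ_v(σ))^{−(k+1)}`:
**`∫_{Γ_K} χ dμ = (χ(g_𝔠) − N𝔠)⁻¹ · Σ_{c ∈ Γ_K/G_m} χ(r_c) · [S⁰] D^k H_{(r_c⁻¹ • e_{𝔣_m}(𝔠))_𝔓}`** (`H_β = Θ(j_m((δ_{E_m} g_β)~) ∘ ϑ)`, `r_c` the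
tower's representatives of `Γ_K/Gal(K̄/K(𝔣_m v))`, `K(𝔣_m v) = K(𝔣_m)`): `integral_twoVariable_eq_sum` with the local integrals evaluated by
`integral_character_pow_succ_localMeasureFamily_eq`.  GIVEN II.2.4 (iii), II.2.5 (i).
[cite: deShalit1987, II.4.14 (38) (p. 71–72), II.4.7 (16)–(17) (p. 60), II.4.12 (29)↔(31) (p. 67–69), I.3.5 (11) (p. 18), II.4.17 (p. 77–78)] -/
theorem integral_twoVariable_character_pow_succ
    (μ : GroupDistribution (SubgroupTower.diagonal (fun m ↦ absRayAdicTower (𝔪' := 𝔣 m) (h𝔣0 m) v)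
        (fun m n ↦ absRayAdicTower_U_anti (h𝔣0 m) (h𝔣0 (m + 1)) v (hle m) n)) ℂ_[2]) (c : I)
    (hμ : ∀ (n : ℕ) (b : absoluteGaloisGroup K ⧸ (absRayAdicTower (𝔪' := 𝔣 n) (h𝔣0 n) v).U n),
        (twisting (g c) (Ideal.absNorm (idl c) : ℂ_[2]) μ).μ n b =
        (GroupDistribution.induceFrom (Γ := absoluteGaloisGroup K) (fun k ↦ rayAdicTower_U_eq_subgroupOf (𝔪 := 𝔣 n) (h𝔣0 n) v k)
          (fun b : GlobalNormCoherentUnits (h𝔣0 n) v ↦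
            localMeasureFamily (h𝔣0 n) (hv n) (hw n) hq h2 u (E n) (hE n) hσ₀ hε θ hθ1 (j n) (hjC n) e₂ (ψ n) (hψ n)
              (RelNormCoherentUnits.ofGlobalUnits (h𝔣0 n) (hv n) (hw n) (isUniformizer_unit_mul h2 u) (hα0 n) (hα𝔣 n) (hαw n)
                (hαπ n) (E n) (hE n) (hdegE n) b))
          zero_le_one (fun _ ↦ le_rfl)
          (ellipticUnitsGlobal h24iii h25 hK ι (h𝔣0 n) (h𝔣1 n) (hv n) (hw n) (hidl0 c) (hidlc c n) (x c n) (hx c n))).μ n b)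
    (m k : ℕ) {χ : absoluteGaloisGroup K → ℂ_[2]} (hχc : (absRayAdicTower (𝔪' := 𝔣 m) (h𝔣0 m) v).IsTowerContinuous χ)
    (hχ : ∀ y z, χ (y * z) = χ y * χ z) (h1 : χ 1 = 1) (hne : χ (g c) ≠ (Ideal.absNorm (idl c) : ℂ_[2]))
    (hχG : ∀ y : ↥(absRestrictNormalHom (rayClassField K (𝔣 m))).ker, χ y =
      padicIntCast ℂ_[2] (((((Units.map (e₂ : v.adicCompletionIntegers K →+* ℤ_[2]).toMonoidHom).comp
        (rayAdicCharacter (h𝔣0 m) (hv m) (hw m)))⁻¹) y : ℤ_[2]) ^ (k + 1))) :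
    μ.integral χ = (χ (g c) - (Ideal.absNorm (idl c) : ℂ_[2]))⁻¹ *
      ∑ c' ∈ (absRayAdicTower (𝔪' := 𝔣 m) (h𝔣0 m) v).cells 0, χ ((absRayAdicTower (𝔪' := 𝔣 m) (h𝔣0 m) v).repr 0 c') *
        PowerSeries.constantCoeff (mahlerD^[k] ((PowerSeries.subst (compSeriesC h2 hσ₀ u hε)
          ((relTildeSeries (isUniformizer_unit_mul h2 u) (E m) hq (hE m) hσ₀
            (LTCoeff.of (v.adicCompletion K) (u : 𝒪[v.adicCompletion K]))
            (RelNormCoherentUnits.ofGlobalUnits (h𝔣0 m) (hv m) (hw m) (isUniformizer_unit_mul h2 u) (hα0 m) (hα𝔣 m) (hαw m)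
              (hαπ m) (E m) (hE m) (hdegE m)
              (((absRayAdicTower (𝔪' := 𝔣 m) (h𝔣0 m) v).repr 0 c')⁻¹ •
                ellipticUnitsGlobal h24iii h25 hK ι (h𝔣0 m) (h𝔣1 m) (hv m) (hw m) (hidl0 c) (hidlc c m) (x c m) (hx c m)))).map
            (j m))).map
          (θ.comp ((CBall (v.adicCompletion K)).subtype.comp
            (algebraMap (UnrCoeff (v.adicCompletion K)) (CBall (v.adicCompletion K))))))) := by
  rw [integral_twoVariable_eq_sum h24iii h25 hK ι 𝔣 h𝔣succ hle hdiv h𝔣0 h𝔣1 hv hw hq h2 u hσ₀ hε θ hθ1 e₂ hΘe α hα0 hα𝔣 hαw f hαπ E hE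
    hdegE hEE j hj hjC hjj ψ hψ idl hidl0 hidlc g x hx μ c hμ m hχc hχ h1 hne]
  congr 1
  refine Finset.sum_congr rfl fun c' _ ↦ ?_
  congr 1
  have hfun : (fun y : ↥(absRestrictNormalHom (rayClassField K (𝔣 m))).ker ↦ χ y) = fun y ↦
      padicIntCast ℂ_[2] (((((Units.map (e₂ : v.adicCompletionIntegers K →+* ℤ_[2]).toMonoidHom).comp
        (rayAdicCharacter (h𝔣0 m) (hv m) (hw m)))⁻¹) y : ℤ_[2]) ^ (k + 1)) := funext hχG
  rw [hfun]
  exact integral_character_pow_succ_localMeasureFamily_eq (h𝔣0 m) (hv m) (hw m) hq h2 u (E m) (hE m) hσ₀ hε θ hθc hθ1 hθζ (j m) (hj m)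
    (hjC m) e₂ hΘe (ψ m) (hψ m) _ k

end Summit.BirchSwinnertonDyer.BirchSwinnertonDyer.Theorems.PrintCf2.EllipticUnitsTwoVariable

end
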